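import Literature.NumberTheory.Automorphic.SatakeParameterGenericBoundFlathProofs
import Literature.NumberTheory.Automorphic.LocalComponentGenericCuspForms
import HarnessLib

/-!
# Jacquet–Shalika's bound `|μ_{j,v}| ≤ q_v^{1/2}`: the assembly with Flath's input discharged

Topic `NumberTheory/Automorphic`; proof file (theorems only, no definition, no named fact) for the
named fact `norm_satakeParameter_le_sqrt` of `AutomorphicLFunctionProofs` (Jacquet–Shalika,
*On Euler products and the classification of automorphic representations I*, Amer. J. Math. **103**
(1981), (5.1.3) p. 554, proved in print by Cor. (2.5) p. 515 and Remark (2.6)(3)).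

The printed architecture (`SatakeParameterGenericBound`) derives the fact in every rank from four
inputs: **(F)** existence of irreducible admissible local components (Flath), **(C)** the
unramified local–global dictionary (Flath), **(A)** genericity of cuspidal local components
(Piatetski-Shapiro, Shalika) and **(B)** Jacquet–Shalika's local Cor. (2.5). Of these, (C) is
discharged in `SatakeParameterGenericBoundFlathProofs`
(`Flath1979_isSatakeParameter_of_hasLocalComponentAt_holds`) and (F) in `GLnCuspidalSpectrumProofs`
(`exists_hasLocalComponentAt_holds`). This leaf records the resulting state of the reduction:

* `norm_satakeParameter_le_sqrt_of_isGeneric_of_normLt` — the named fact from **(A)** and **(B)**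
  alone (the two remaining named facts `Shalika1974_isGeneric_of_hasLocalComponentAt` and
  `JacquetShalika1981_norm_lt_sqrt_of_isGeneric`);
* `norm_satakeParameter_le_sqrt_of_cuspFormZeroDetection_of_normLt` — the named fact from **(B)**
  and the *zero-detection of continuous cusp forms by their Whittaker coefficients* (the
  Fourier–Whittaker expansion, Cogdell (2004), Thm. 1.1; the proved reduction
  `Shalika1974_isGeneric_of_hasLocalComponentAt_of_cuspFormZeroDetection` of
  `LocalComponentGenericCuspForms`).

Unconditionally the fact is known in the tree for `n ≤ 2` (`norm_satakeParameter_le_sqrt_of_le_two`,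
`SatakeParameterRankTwoBound`), and (B) for `n ≤ 2` (`JacquetShalika1981_norm_lt_sqrt_of_isGeneric_of_le_one`,
`JacquetShalika1981_norm_lt_sqrt_of_isGeneric_two`); for `n ≥ 3` the remaining inputs are exactly
(A) (equivalently the zero-detection) and (B) (equivalently, by `SatakeParameterGenericBoundProofs`,
the finiteness at `s = 1` of the unramified Rankin–Selberg self torus sum, Jacquet–Shalika's §1).

## References

* H. Jacquet, J. A. Shalika, *On Euler products and the classification of automorphic
  representations I*, Amer. J. Math. 103 (1981): (5.1.3) p. 554, Cor. (2.5) p. 515, Remark (2.6)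
  [JacquetShalikaAJM1981].
* J. W. Cogdell, *Analytic theory of L-functions for GL_n*, in: An Introduction to the Langlands
  Program (2004), §1.1 Thm. 1.1, §1.2 [CogdellAnalyticTheory2004].
* D. Flath, *Decomposition of representations into tensor products*, Corvallis (1979), Thm. 3
  [Flath1979].
-/

noncomputable section

open scoped MatrixGroups
open NumberField IsDedekindDomain MeasureTheory

namespace Literature.NumberTheory.Automorphic

section Assembly

variable {n : ℕ} {K : Type} [Field K] [NumberField K]
  {μ : Measure (AdelicGroupData.gl n K).automorphicQuotient}
  [(AdelicGroupData.gl n K).IsAutomorphicMeasure μ]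

/-- **Jacquet–Shalika's (5.1.3) from (A) genericity and (B) Cor. (2.5) alone.** With the existence
of irreducible admissible local components (`exists_hasLocalComponentAt_holds`, Flath) and the
unramified dictionary (`Flath1979_isSatakeParameter_of_hasLocalComponentAt_holds`) proved in the
tree, the named fact `norm_satakeParameter_le_sqrt` follows from the genericity of cuspidal local
components (`Shalika1974_isGeneric_of_hasLocalComponentAt`) and Jacquet–Shalika's local Cor. (2.5)
for the fields `K_v` (`JacquetShalika1981_norm_lt_sqrt_of_isGeneric`) — the proof of (5.1.3)
indicated in Remark (2.6)(3) of the source.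
[cite: JacquetShalikaAJM1981, (5.1.3) p. 554, Cor. (2.5) p. 515, Remark (2.6)(3)] -/
theorem norm_satakeParameter_le_sqrt_of_isGeneric_of_normLt
    (hA : Shalika1974_isGeneric_of_hasLocalComponentAt (n := n) (K := K) (μ := μ))
    (hB : ∀ (v : HeightOneSpectrum (𝓞 K)) {V : Type} [AddCommGroup V] [Module ℂ V]
      (ρ : Representation ℂ (GL (Fin n) (v.adicCompletion K)) V),
      JacquetShalika1981_norm_lt_sqrt_of_isGeneric ρ) :
    norm_satakeParameter_le_sqrt (n := n) (K := K) (μ := μ) :=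
  norm_satakeParameter_le_sqrt_of_isGeneric' exists_hasLocalComponentAt_holds hA hB

/-- **Jacquet–Shalika's (5.1.3) from the zero-detection of continuous cusp forms and Cor. (2.5).**
If every non-zero continuous cusp form on `GL_n(𝔸_K) ⧸ A_G GL_n(K)` has a non-zero global
Whittaker coefficient (the Fourier–Whittaker expansion of Piatetski-Shapiro and Shalika; Cogdell
(2004), Thm. 1.1 p. 176), then the local components are generic
(`Shalika1974_isGeneric_of_hasLocalComponentAt_of_cuspFormZeroDetection`, Cogdell (2004), §1.2),
and (5.1.3) follows from Cor. (2.5) by `norm_satakeParameter_le_sqrt_of_isGeneric_of_normLt`.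
[cite: JacquetShalikaAJM1981, (5.1.3) p. 554, Remark (2.6)(3)]
[cite: CogdellAnalyticTheory2004, §1.2 p. 179 (Thm. 1.1 p. 176)] -/
theorem norm_satakeParameter_le_sqrt_of_cuspFormZeroDetection_of_normLt
    (hZ : ∀ [MeasurableSpace ↥(adelicUnipotent n K)] [BorelSpace ↥(adelicUnipotent n K)]
      (ν : Measure ↥(adelicUnipotent n K)) [ν.IsHaarMeasure]
      (Φ : (AdelicGroupData.gl n K).automorphicQuotient → ℂ), IsContinuousCuspForm n K μ Φ → Φ ≠ 0 →
      ∃ g : GL (Fin n) (AdeleRing (𝓞 K) K),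
        whittakerCoeff ν (unipotentTateDomain n K) (adeleAddChar K)
          (invQuot (AdelicGroupData.gl n K) Φ) g ≠ 0)
    (hB : ∀ (v : HeightOneSpectrum (𝓞 K)) {V : Type} [AddCommGroup V] [Module ℂ V]
      (ρ : Representation ℂ (GL (Fin n) (v.adicCompletion K)) V),
      JacquetShalika1981_norm_lt_sqrt_of_isGeneric ρ) :
    norm_satakeParameter_le_sqrt (n := n) (K := K) (μ := μ) :=
  norm_satakeParameter_le_sqrt_of_isGeneric_of_normLt
    (Shalika1974_isGeneric_of_hasLocalComponentAt_of_cuspFormZeroDetection hZ) hB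

end Assembly

end Literature.NumberTheory.Automorphic
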